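import Summits.ValiantsHypothesis.ValiantsHypothesis.Theses.FermionizationDimension
import Summits.ValiantsHypothesis.ValiantsHypothesis.Theses.TwistedDetRank
import Summits.ValiantsHypothesis.ValiantsHypothesis.Theorems.TwistedDetRankTdrBlockMonotone
import Summits.ValiantsHypothesis.ValiantsHypothesis.Theorems.FermionizationDimensionSDimPerNotQPSuperpolyTransfer

/-!
# Route FermionizationDimension — crux `SDimPerNotQP` (stmt-ValiantsHypothesis-7286):
# the sibling crux `DirectSumExp` settles `SDimUnbounded`

Auxiliary registered stubs of the line `registered` of `Cruxes/SDimPerNotQP/Lines/birth.lean`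
(cross-route glue produced by the line's calibration `stub_expansionBound` /
`stub_superpolyTransfer`):

* `stub_superpolyOfDirectSumExp` — `TwistedDetRank.DirectSumExp` (stmt-ValiantsHypothesis-6285:
  every representation of `per_3 ⊕ ⋯ ⊕ per_3` (`m` blocks) by `r` twisted determinants has
  `r ≥ 2^(c m)`) makes the twisted-determinantal rank of the permanent eventually exceed every
  polynomial: block restriction (`TdrBlockMonotone`, proved in tree as `tdrBlockMonotone_proof`)
  with `m = ⌊n/3⌋` gives `tdr(per_n) ≥ 2^(c ⌊n/3⌋) > n^C` for `n ≥ n₀(c, C)` (real analysis: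
  `K (m+1)^C < b^m` eventually for `b = 2^c > 1`, `eventually_mul_pow_lt_pow`).
* `stub_sDimUnboundedOfDirectSumExp` — hence, by `stub_superpolyTransfer`
  (Theorems/FermionizationDimensionSDimPerNotQPSuperpolyTransfer.lean), `DirectSumExp → SDimUnbounded`
  (the route's crux stmt-ValiantsHypothesis-7288, BY NAME): the sibling route's rank-4 crux settles
  this route's rank-4 crux.

Sources: folklore; the real-analysis idiom of Theorems/TwistedDetRankDirectSumToTdr.lean.
-/

-- `Summit.<Summit>.<Problem>` repeats `ValiantsHypothesis` by the tree's layout convention (D-0017).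
set_option linter.dupNamespace false

namespace Summit.ValiantsHypothesis.ValiantsHypothesis.Theorems

namespace FermionizationDimensionSDimPerNotQPDirectSumExpTransfer

open Filter Topology

/-- Analytic core: for `b > 1`, `K > 0` and a natural exponent `C`, eventually
`K · (m+1)^C < b^m`. [folklore] -/
theorem eventually_mul_pow_lt_pow (b K : ℝ) (hb : 1 < b) (hK : 0 < K) (C : ℕ) :
    ∃ m₀ : ℕ, ∀ m ≥ m₀, K * (((m + 1 : ℕ) : ℝ)) ^ C < b ^ m := by
  have hb0 : 0 < b := lt_trans one_pos hb
  have h1 : Tendsto (fun m : ℕ => (((m + 1 : ℕ) : ℝ)) ^ C / b ^ (m + 1)) atTop (𝓝 0) :=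
    (tendsto_pow_const_div_const_pow_of_one_lt C hb).comp (tendsto_add_atTop_nat 1)
  have h2 : ∀ᶠ m : ℕ in atTop, (((m + 1 : ℕ) : ℝ)) ^ C / b ^ (m + 1) < 1 / (K * b) :=
    h1.eventually (gt_mem_nhds (by positivity))
  obtain ⟨m₀, hm₀⟩ := Filter.eventually_atTop.1 h2
  refine ⟨m₀, fun m hm => ?_⟩
  have h := hm₀ m hm
  rw [div_lt_div_iff₀ (by positivity) (by positivity), one_mul, pow_succ] at h
  -- `h : (m+1)^C * (K * b) < b^m * b`
  nlinarith [h, hb0, pow_pos hb0 m]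

end FermionizationDimensionSDimPerNotQPDirectSumExpTransfer

open FermionizationDimensionSDimPerNotQPDirectSumExpTransfer in
/-- **`DirectSumExp` makes `tdr(per_n)` super-polynomial** (auxiliary registered stub
`stub_superpolyOfDirectSumExp` of the line `registered` of crux `SDimPerNotQP`,
stmt-ValiantsHypothesis-7286): with `m = ⌊n/3⌋` blocks, `tdr(per_n) ≥ 2^(c m) > n^C` for all
large `n`. [folklore] -/
theorem stub_superpolyOfDirectSumExp :
    Summit.ValiantsHypothesis.ValiantsHypothesis.Theses.TwistedDetRank.DirectSumExp → ∀ C : ℕ, ∃ n₀ : ℕ, ∀ n ≥ n₀, ∀ (r : ℕ) (E : Fin r → Matrix (Fin n) (Fin n) ℂ), Literature.Computability.AlgebraicComplexity.perPoly (Fin n) ℂ = ∑ t, (Matrix.of fun i j => MvPolynomial.C (E t i j) * MvPolynomial.X (i, j)).det → n ^ C < r := by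
  unfold Summit.ValiantsHypothesis.ValiantsHypothesis.Theses.TwistedDetRank.DirectSumExp
  rintro ⟨c, hc, hDS⟩ C
  have hBM := tdrBlockMonotone_proof
  unfold Summit.ValiantsHypothesis.ValiantsHypothesis.Theses.TwistedDetRank.TdrBlockMonotone at hBM
  -- `b = 2^c > 1`; eventually `3^C (m+1)^C < b^m`
  have hb : (1 : ℝ) < (2 : ℝ) ^ c := Real.one_lt_rpow (by norm_num) hc
  obtain ⟨m₀, hm₀⟩ := eventually_mul_pow_lt_pow ((2 : ℝ) ^ c) ((3 : ℝ) ^ C) hb (by positivity) C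
  refine ⟨3 * (m₀ + 1), fun n hn r E hE => ?_⟩
  -- `m = ⌊n/3⌋ ≥ m₀ + 1 ≥ 1`, `3m ≤ n < 3(m+1)`
  set m := n / 3 with hm
  have hm1 : m₀ + 1 ≤ m := by
    rw [hm]; exact (Nat.le_div_iff_mul_le (by norm_num)).2 (by omega)
  have h3m : 3 * m ≤ n := by rw [hm]; omega
  have hn3 : n < 3 * (m + 1) := by rw [hm]; omega
  obtain ⟨E', hE'⟩ := hBM n m r (by omega) h3m E hE
  have h2 := hDS m r E' hE'
  -- `n^C < 3^C (m+1)^C < (2^c)^m = 2^(c m) ≤ r`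
  have hlt : ((n : ℝ)) ^ C < (2 : ℝ) ^ (c * m) := by
    have hn3' : (n : ℝ) < 3 * (((m + 1 : ℕ) : ℝ)) := by exact_mod_cast hn3
    have step1 : ((n : ℝ)) ^ C ≤ (3 * (((m + 1 : ℕ) : ℝ))) ^ C :=
      pow_le_pow_left₀ (Nat.cast_nonneg n) hn3'.le C
    have step2 : (3 * (((m + 1 : ℕ) : ℝ))) ^ C = (3 : ℝ) ^ C * (((m + 1 : ℕ) : ℝ)) ^ C :=
      mul_pow _ _ _
    have step3 := hm₀ m (by omega)
    have step4 : ((2 : ℝ) ^ c) ^ m = (2 : ℝ) ^ (c * m) := by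
      rw [← Real.rpow_natCast ((2 : ℝ) ^ c) m, ← Real.rpow_mul (by norm_num)]
    calc ((n : ℝ)) ^ C ≤ (3 : ℝ) ^ C * (((m + 1 : ℕ) : ℝ)) ^ C := step1.trans step2.le
      _ < ((2 : ℝ) ^ c) ^ m := step3
      _ = (2 : ℝ) ^ (c * m) := step4
  have hfin : ((n : ℝ)) ^ C < (r : ℝ) := hlt.trans_le h2
  exact_mod_cast hfin

/-- **`DirectSumExp → SDimUnbounded`** (auxiliary registered stub
`stub_sDimUnboundedOfDirectSumExp` of the line `registered` of crux `SDimPerNotQP`,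
stmt-ValiantsHypothesis-7286): the sibling route's crux `DirectSumExp` (stmt-6285) settles this
route's crux `SDimUnbounded` (stmt-7288), by `stub_superpolyOfDirectSumExp` and the landed
`stub_superpolyTransfer`. [folklore] -/
theorem stub_sDimUnboundedOfDirectSumExp :
    Summit.ValiantsHypothesis.ValiantsHypothesis.Theses.TwistedDetRank.DirectSumExp → Summit.ValiantsHypothesis.ValiantsHypothesis.Theses.FermionizationDimension.SDimUnbounded :=
  fun h => stub_superpolyTransfer (stub_superpolyOfDirectSumExp h)

end Summit.ValiantsHypothesis.ValiantsHypothesis.Theorems
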